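import Summits.ABC.IUTFork.Cor312VolumesSummands
import Summits.ABC.IUTFork.Cor312StatementBridge
import HarnessLib

/-!
# [IUTchIII] Corollary 3.12, statement — the verbatim container: consequences for the possible images
# (`BridgeHyps.image_adm` / `image_fin` / `theta_nonempty` / `mono` discharged)

PROOF-ONLY companion (no definitions) of `Cor312VolumesSummands` (abc-iut cell, Cor. 3.12 sub-crew, seat
abc-iut-c312-5 gen 2; D-0067 TEAM A row A-0); TAKES NO SIDE. For a `Cor312.Setting P` (c312-7) over a situation
whose line `S.D P.n` REALIZES the verbatim mono-analytic container `V : SummandPieces S.L` ([IUTchIII] Rmk. 3.1.1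
(ii)(iii): direct product regions over the summands, normalized weighted log-volumes) and whose (Ind1)/(Ind2)
generators are intertwined with container-preserving maps (`GeneratorsPreserve`, proved for the real prime
packets in `Cor312VolumesPadicSummands`), the possible images of the Θ-pilot object (c312-7 `possibleImages` =
`indGroup`-translates of the (Ind3)-enlarged region `thetaRegion3`) are all admissible with the SAME log-volume as
the Θ-region (proof of Cor. 3.12, Step (x), kurims `paper:url-4b091feeb646` p. 181 l. 5–13: "the
procession-normalized mono-analytic log-volumes … are invariant with respect to the indeterminacies (Ind1),
(Ind2)"), whence c312-6's `BridgeHyps` fields `image_adm`, `image_fin`, `theta_nonempty`, `mono` from TWO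
properties of the Θ-region alone (admissible; log-volume finitely supported over `v_ℚ`, Prop. 3.9 (iii)) —
`bridgeHyps_of_summands`, leaving `hul_nonempty` and `ThetaFinite` (c312-7 `hullDefined_of_stable`) as the named
inputs. [claim: Mochizuki2012, status: disputed] for the quoted sentence; every theorem is [folklore] bookkeeping.
Deliberately NOT here: the Θ-boxes (c312-3 `Ind3Datum`), any judgement.
-/

noncomputable section

open Set Function

namespace Summit.ABC

namespace IUTFork

namespace Cor312Vol

open Thm311 Cor312 Literature.IUT.LogThetaLattice

variable {T : ThetaIndex}

namespace SummandPieces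

section Setting

variable {S : Situation T} {V : SummandPieces S.L} {P : Cor312.Setting S}

/-- **Every possible image of the Θ-pilot object is admissible and has the log-volume of the (Ind3)-enlarged
Θ-region** (proof of Cor. 3.12, Step (x), p. 181 l. 5–13; the possible images are the `indGroup`-translates of
`thetaRegion3`, c312-7 `Setting.possibleImages`), as soon as the Θ-region itself is admissible.
[claim: Mochizuki2012, status: disputed] -/
theorem adm_and_logvol_possibleImage_eq (hD : V.Realizes (S.D P.n)) (hG : V.GeneratorsPreserve)
    {j : T.Label} {vQ : T.VQ} (hθ : (S.D P.n).Adm j vQ (P.thetaRegion3 j vQ))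
    {U : Set (S.L.Packet j vQ)} (hU : U ∈ P.possibleImages j vQ) :
    (S.D P.n).Adm j vQ U ∧ (S.D P.n).logvol j vQ U = (S.D P.n).logvol j vQ (P.thetaRegion3 j vQ) := by
  obtain ⟨Φ, hΦ, rfl⟩ := hU
  exact adm_and_logvol_eq_of_mem_indGroup hD hG hΦ j vQ _ hθ

/-- **`BridgeHyps.image_adm` DISCHARGED** for this container: every possible image at a label `j ∈ 𝔽_l^⋇` is
admissible, given admissibility of the Θ-region. [folklore] -/
theorem image_adm_of_theta_adm (hD : V.Realizes (S.D P.n)) (hG : V.GeneratorsPreserve)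
    (hθ : ∀ (i : Fin T.lstar) (vQ : T.VQ), (S.D P.n).Adm _ vQ (P.thetaRegion3 (Setting.labelSucc i) vQ)) :
    ∀ (i : Fin T.lstar) (vQ : T.VQ), ∀ U ∈ P.possibleImages (Setting.labelSucc i) vQ, (S.D P.n).Adm _ vQ U :=
  fun i vQ _ hU => (adm_and_logvol_possibleImage_eq hD hG (hθ i vQ) hU).1

/-- **`BridgeHyps.image_fin` DISCHARGED** for this container: along every global choice of possible images the
weighted log-volumes are finitely supported over `(j, v_ℚ)`, given that the Θ-region's log-volume is finitely
supported over `v_ℚ` at each label ([IUTchIII] Prop. 3.9 (iii): "all but finitely many of which are zero").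
[folklore] -/
theorem image_fin_of_theta_fin (hD : V.Realizes (S.D P.n)) (hG : V.GeneratorsPreserve)
    (hθ : ∀ (i : Fin T.lstar) (vQ : T.VQ), (S.D P.n).Adm _ vQ (P.thetaRegion3 (Setting.labelSucc i) vQ))
    (hfin : ∀ i : Fin T.lstar, (Function.support fun vQ : T.VQ =>
      (S.D P.n).logvol _ vQ (P.thetaRegion3 (Setting.labelSucc i) vQ)).Finite) :
    ∀ U : ImageChoice P, (Function.support fun t : Fin T.lstar × T.VQ =>
      (1 / (T.lstar : ℝ)) * (S.D P.n).logvol _ t.2 (U.1 t)).Finite := by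
  intro U
  have hbig : (⋃ i : Fin T.lstar, (fun vQ : T.VQ => (i, vQ)) '' Function.support fun vQ : T.VQ =>
      (S.D P.n).logvol _ vQ (P.thetaRegion3 (Setting.labelSucc i) vQ)).Finite :=
    Set.finite_iUnion fun i => (hfin i).image _
  refine hbig.subset fun t ht => ?_
  simp only [Function.mem_support, ne_eq, mul_eq_zero, not_or] at ht
  refine Set.mem_iUnion.2 ⟨t.1, ⟨t.2, ?_, rfl⟩⟩
  rw [Function.mem_support, ← (adm_and_logvol_possibleImage_eq hD hG (hθ t.1 t.2) (U.2 t)).2]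
  exact ht.2

/-- **`BridgeHyps.mono` DISCHARGED** (`LogvolMono`). [folklore] -/
theorem logvolMono_of_realizes (hD : V.Realizes (S.D P.n)) : LogvolMono P :=
  fun _ _ _ _ hA hB hAB => V.logvol_mono_of_realizes hD hA hB hAB

/-- **`BridgeHyps` over the verbatim container**, with `mono`, `image_adm`, `image_fin`, `theta_nonempty`
DISCHARGED; still ASKED (owners: c312-3 `Ind3Datum` for the Θ-boxes, c312-7 `hullDefined_of_stable` for
`ThetaFinite`): the Θ-region admissible with finitely supported log-volume, hull-sets nonempty, `ThetaFinite`.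
[folklore] -/
theorem bridgeHyps_of_summands (hD : V.Realizes (S.D P.n)) (hG : V.GeneratorsPreserve)
    (hθ : ∀ (i : Fin T.lstar) (vQ : T.VQ), (S.D P.n).Adm _ vQ (P.thetaRegion3 (Setting.labelSucc i) vQ))
    (hfin : ∀ i : Fin T.lstar, (Function.support fun vQ : T.VQ =>
      (S.D P.n).logvol _ vQ (P.thetaRegion3 (Setting.labelSucc i) vQ)).Finite)
    (hul_nonempty : ∀ (j : T.Label) (vQ : T.VQ), ∀ H ∈ (P.frame j vQ).Hul, H.Nonempty)
    (finite : P.ThetaFinite) : BridgeHyps P where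
  mono := logvolMono_of_realizes hD
  image_adm := image_adm_of_theta_adm hD hG hθ
  image_fin := image_fin_of_theta_fin hD hG hθ hfin
  hul_nonempty := hul_nonempty
  theta_nonempty i vQ := Adm.nonempty ((hD.adm_iff _ vQ _).1 (hθ i vQ))
  finite := finite

end Setting

end SummandPieces

end Cor312Vol

end IUTFork

end Summit.ABC

end
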